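import Summits.BirchSwinnertonDyer.BirchSwinnertonDyer.Theorems.RamifiedSevenEllipticUnitsRigidityArchimedean
import Literature.NumberTheory.GaloisRepresentations.HeckeCharacterGrossencharakterRelationProofs
import Mathlib.NumberTheory.NumberField.ClassNumber
import HarnessLib

set_option linter.dupNamespace false
set_option autoImplicit false

/-!
# Rigidity bridge, algebraic end — part 2: value PAIRS ⇒ `φ = ψ ∨ φ = ψ ∘ c`

Helper file for the K7r Value crux `EllipticUnitValueSevenOfGZK` (stmt-BirchSwinnertonDyer-19945), line
`rubin-formula-zp` v4.2 (skeleton `bd085e9ecccbb7e3`), registered stub H_Rig⁰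
`stub_pinnedCharacterRigiditySeven`; the ALGEBRAIC end (R3)+(R4) of planner D169's partition of the
rigidity programme (sequel of `…RigidityArchimedean`). MAIN RESULT `Rigidity.eq_or_eq_galConj_of_valuePairs`:
for `K` imaginary quadratic, `c ≠ 1`, `ψ` of infinity type `(1, 0)` and `φ` an ARBITRARY Hecke character,
the pair disjunction «`(φ(ϖ_w), φ(ϖ_{cw})) = (ψ(ϖ_w), ψ(ϖ_{cw}))` up to order, for almost all `w`» implies
`φ = ψ ∨ φ = HeckeCharacter.galConj c ψ`. The interface is the `hpair` currency of seat k7r-c2's (R2)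
(`LemmaXi.sq_norm_φac_value_sub_one_le_of_pair`), under `∀ᶠ w in cofinite`.

MECHANISM (no density, no non-vanishing, class-number-free): by part 1, `φ` has parameters
`(ν, k) = (−1/2, k)` at the infinite place. §3: Neukirch (6.13) in its `M`-th-power form (tree, S5
`IsModulus.exists_pos_forall_pow_coe_apply_infiniteIdeles_mul_idealPow_eq_one`) on the principal power
`𝔭_w^h = (a)` of a prime (`h` = class number exponent, `exists_pow_asIdeal_eq_span`) relates `φ(ϖ_w)^h`
to `φ((a)_∞) = |σa|⁻¹ (σa/|σa|)^k` and `ψ(ϖ_w)^h` to `σ(a)⁻¹`, up to roots of unity; at a SPLIT place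
(`c w ≠ w`) the unswapped alternative forces `(σa/|σa|)^{(k+1)N} = 1`, the swapped one
`(σa/|σa|)^{(k−1)N} = 1`, and `σa/|σa|` is NOT a root of unity because `(a) ≠ (ca)`
(`smul_eq_of_div_norm_zpow_eq_one`). §4: hence the SIGN of the global parameter `k` decides the
alternative at every place at once, and GL(1) rigidity (`ext_of_eventually_valueAtUniformizer_eq`)
concludes.

HONEST FRAMING: a kernel theorem about Hecke characters of imaginary quadratic fields; it discharges no
stub by itself (the composition with (R1)/(R2) is seat k7r-c2's); nothing about BSD is claimed; the crux
19945 stays OPEN; no named fact is introduced.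

References: Neukirch, *Algebraic Number Theory* VII §6 (6.13)–(6.14); Cassels–Fröhlich VII §4 Prop. 4.1;
Booker–Krishnamurthy, Compositio 147 (2011) §1.1.
-/

noncomputable section

open scoped Classical ComplexConjugate Pointwise nonZeroDivisors
open Filter NumberField NumberField.InfinitePlace IsDedekindDomain
  Literature.NumberTheory.GaloisRepresentations
  Literature.NumberTheory.GaloisRepresentations.HeckeCharacter
  Literature.NumberTheory.Automorphic
  Literature.NumberTheory.QuadraticForms
  Literature.NumberTheory.EllipticCurves
  Literature.NumberTheory.LFunctions

namespace Summit.BirchSwinnertonDyer.BirchSwinnertonDyer.Theorems.RamifiedSevenEllipticUnits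

namespace Rigidity

variable {K : Type} [Field K] [NumberField K]

/-! ## §3 Principal powers of primes: Neukirch (6.13) and the archimedean parameter `k` -/

/-- **Neukirch (6.13) on the `h`-th power of a prime**: every Hecke character `χ` has a finite set
`T` of places (off which it is unramified) and `M ≥ 1` with `(χ((a)_∞) · χ(ϖ_w)^h)^M = 1` whenever
`𝔭_w^h = (a)`, `w ∉ T`. [cite: NeukirchANT1999, Ch. VII §6 Prop. (6.13) (proof) and Cor. (6.14)] -/
theorem exists_finset_pow_rel (χ : HeckeCharacter K) :
    ∃ (T : Finset (HeightOneSpectrum (𝓞 K))) (M : ℕ), 0 < M ∧ (∀ w ∉ T, χ.IsUnramifiedAt w) ∧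
      ∀ {w : HeightOneSpectrum (𝓞 K)} (_ : w ∉ T) {a : 𝓞 K} (ha : (a : K) ≠ 0) (h : ℕ),
        w.asIdeal ^ h = Ideal.span {a} →
        ((χ (infiniteIdeles K (globalToInfiniteUnits K (Units.mk0 (a : K) ha))) : ℂ) *
          χ.valueAtUniformizer w ^ h) ^ M = 1 := by
  obtain ⟨T, e, hmod⟩ := χ.exists_isModulus
  obtain ⟨M, hM, hrel⟩ := hmod.exists_pos_forall_pow_coe_apply_infiniteIdeles_mul_idealPow_eq_one
  refine ⟨T, M, hM, fun w hw ↦ isUnramifiedAt_of_isModulus' hmod hw, fun {w} hw {a} ha h hspan ↦ ?_⟩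
  have hcop : IsCoprime (Ideal.span {a}) (modulusIdeal T e) := by
    rw [← hspan]
    exact (isCoprime_asIdeal_modulusIdeal_of_not_mem e hw).pow_left
  have := hrel ha hcop
  rwa [← hspan, idealPow_pow _ w.ne_bot, idealPow_asIdeal] at this

variable (K) in
/-- **A power of every prime is principal** (finiteness of the class group): there is `h ≥ 1` with
`𝔭_w^h = (a_w)` for every finite place `w`. [folklore] -/
theorem exists_pow_asIdeal_eq_span : ∃ h : ℕ, 0 < h ∧
    ∀ w : HeightOneSpectrum (𝓞 K), ∃ a : 𝓞 K, (a : K) ≠ 0 ∧ w.asIdeal ^ h = Ideal.span {a} := by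
  refine ⟨Fintype.card (ClassGroup (𝓞 K)), Fintype.card_pos, fun w ↦ ?_⟩
  have hI : w.asIdeal ^ Fintype.card (ClassGroup (𝓞 K)) ∈ (Ideal (𝓞 K))⁰ :=
    mem_nonZeroDivisors_iff_ne_zero.mpr (pow_ne_zero _ w.ne_bot)
  have h1 : ClassGroup.mk0 ⟨_, hI⟩ = 1 := by
    have : (⟨_, hI⟩ : (Ideal (𝓞 K))⁰) =
        ⟨w.asIdeal, mem_nonZeroDivisors_iff_ne_zero.mpr w.ne_bot⟩ ^ Fintype.card (ClassGroup (𝓞 K)) :=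
      Subtype.ext rfl
    rw [this, map_pow, pow_card_eq_one]
  obtain ⟨a, ha⟩ := ((ClassGroup.mk0_eq_one_iff hI).mp h1).principal
  have ha0 : a ≠ 0 := by
    rintro rfl
    apply pow_ne_zero (Fintype.card (ClassGroup (𝓞 K))) w.ne_bot
    rw [ha]
    exact Ideal.span_singleton_eq_bot.mpr rfl
  exact ⟨a, fun h ↦ ha0 (by exact_mod_cast h), ha⟩

/-- Transport of a principal power of a prime: `𝔭_{c w}^h = (c a)` if `𝔭_w^h = (a)`. [folklore] -/
theorem smul_asIdeal_pow_eq_span (c : K ≃ₐ[ℚ] K) {w : HeightOneSpectrum (𝓞 K)} {a : 𝓞 K}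
    {h : ℕ} (hspan : w.asIdeal ^ h = Ideal.span {a}) :
    (c • w).asIdeal ^ h = Ideal.span {c • a} := by
  rw [HeightOneSpectrum.smul_asIdeal, ← smul_pow', hspan, Ideal.pointwise_smul_def, Ideal.map_span,
    Set.image_singleton]
  rfl

/-- **`ϖ/ϖ̄` is not a root of unity at a split prime.** If `𝔭_w^h = (a)` (`h ≥ 1`) and
`(σa/|σa|)^m = 1` for some `m ≠ 0` (`σ : K → ℂ`, `K` imaginary quadratic, `c ≠ 1`), then
`c • w = w`: indeed `(σa/|σa|)² = σ(a)/σ(ca)`, so `a^m = (ca)^m`, `𝔭_w^{h|m|} = 𝔭_{cw}^{h|m|}`.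
[folklore] -/
theorem smul_eq_of_div_norm_zpow_eq_one (hK : IsImaginaryQuadratic K) (c : K ≃ₐ[ℚ] K) (hc : c ≠ 1)
    (σ : K →+* ℂ) {w : HeightOneSpectrum (𝓞 K)} {a : 𝓞 K} (ha : (a : K) ≠ 0) {h : ℕ} (hh : 0 < h)
    (hspan : w.asIdeal ^ h = Ideal.span {a}) {m : ℤ} (hm : m ≠ 0)
    (hu : (σ a / (‖σ a‖ : ℂ)) ^ m = 1) : c • w = w := by
  haveI : IsTotallyComplex K := hK.2
  have hz : σ a ≠ 0 := (map_ne_zero σ).mpr ha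
  have hconj : conj (σ a) = σ (c a) :=
    LemmaXi.conj_embedding_eq_embedding_algEquiv hK.1 c hc σ
      (IsTotallyComplex.complexEmbedding_not_isReal σ) a
  have hcz : σ (c a) ≠ 0 := by rw [← hconj]; exact (map_ne_zero _).mpr hz
  have hr2 : ((‖σ a‖ : ℂ)) * (‖σ a‖ : ℂ) = σ a * conj (σ a) := by
    rw [Complex.mul_conj, Complex.normSq_eq_norm_sq]; push_cast; ring
  -- `u² = σ a / σ (c a)`
  have hu2 : (σ a / (‖σ a‖ : ℂ)) ^ (2 : ℤ) = σ a / σ (c a) := by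
    rw [← hconj, zpow_two, div_mul_div_comm, hr2, mul_div_mul_left _ _ hz]
  -- hence `σ(a)^m = σ(c a)^m`
  have hm' : (σ a / σ (c a)) ^ m = 1 := by
    rw [← hu2, ← zpow_mul, mul_comm, zpow_mul, hu, one_zpow]
  rw [div_zpow, div_eq_one_iff_eq (zpow_ne_zero _ hcz), ← map_zpow₀ σ, ← map_zpow₀ σ] at hm'
  have hK' : (a : K) ^ m = (c a) ^ m := σ.injective hm'
  -- natural exponent `n = |m|`
  have hn : (a : K) ^ m.natAbs = (c a) ^ m.natAbs := by
    rcases Int.natAbs_eq m with h | h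
    · rw [h, zpow_natCast, zpow_natCast] at hK'; exact hK'
    · rw [h, zpow_neg, zpow_neg, inv_inj, zpow_natCast, zpow_natCast] at hK'; exact hK'
  have hn' : a ^ m.natAbs = (c • a) ^ m.natAbs := by
    apply RingOfIntegers.coe_injective
    simp only [RingOfIntegers.coe_eq_algebraMap, map_pow] at hn ⊢
    rw [← RingOfIntegers.coe_eq_algebraMap, ← RingOfIntegers.coe_eq_algebraMap,
      RingOfIntegers.coe_algEquiv_smul]
    exact hn
  -- ideals
  have hI : w.asIdeal ^ (h * m.natAbs) = (c • w).asIdeal ^ (h * m.natAbs) := by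
    rw [pow_mul, pow_mul, hspan, smul_asIdeal_pow_eq_span c hspan, Ideal.span_singleton_pow,
      Ideal.span_singleton_pow, hn']
  have hN : h * m.natAbs ≠ 0 := mul_ne_zero hh.ne' (Int.natAbs_ne_zero.mpr hm)
  have hle : (c • w).asIdeal ≤ w.asIdeal := by
    have : (c • w).asIdeal ^ (h * m.natAbs) ≤ w.asIdeal := by
      rw [← hI]; exact Ideal.pow_le_self hN
    exact (Ideal.IsPrime.pow_le_iff hN).mp this
  exact HeightOneSpectrum.ext ((c • w).isMaximal.eq_of_le w.isPrime.ne_top hle)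

/-- Cancelling a common nonzero factor in two `M`-th power relations. [folklore] -/
theorem pow_eq_pow_of_mul_pow_eq_one {x x' v : ℂ} {M M' : ℕ} (h1 : (x * v) ^ M = 1)
    (h2 : (x' * v) ^ M' = 1) (hv : v ≠ 0) : x ^ (M * M') = x' ^ (M * M') := by
  have e1 : (x * v) ^ (M * M') = 1 := by rw [pow_mul, h1, one_pow]
  have e2 : (x' * v) ^ (M * M') = 1 := by rw [mul_comm M M', pow_mul, h2, one_pow]
  rw [mul_pow] at e1 e2
  exact mul_right_cancel₀ (pow_ne_zero _ hv) (e1.trans e2.symm)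

/-- `(r²)^{−1/2} = r⁻¹` for `r > 0` (complex power of a positive real). [folklore] -/
theorem ofReal_sq_cpow_neg_half {r : ℝ} (hr : 0 < r) :
    (((r ^ 2 : ℝ)) : ℂ) ^ (-1 / 2 : ℂ) = ((r : ℂ))⁻¹ := by
  rw [show (-1 / 2 : ℂ) = ((-(1 / 2) : ℝ) : ℂ) by push_cast; ring,
    ← Complex.ofReal_cpow (by positivity), ← Complex.ofReal_inv, Real.rpow_neg (by positivity),
    ← Real.sqrt_eq_rpow, Real.sqrt_sq hr.le]

/-! ## §4 Rigidity from value pairs -/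

/-- **RIGIDITY FROM VALUE PAIRS** — the algebraic end (R3)+(R4) of the rigidity bridge H_Rig⁰ of the
line `rubin-formula-zp` (planner D169). Let `K` be imaginary quadratic, `c ≠ 1` its non-trivial
automorphism, `ψ` a Hecke character of infinity type `(1, 0)` and `φ` an ARBITRARY Hecke character.
If at almost every finite place `w` the pair `(φ(ϖ_w), φ(ϖ_{c w}))` equals `(ψ(ϖ_w), ψ(ϖ_{c w}))`
up to order, then `φ = ψ` or `φ = ψ ∘ c`. PROOF: (i) the symmetric products agree, `φ·(φ∘c) = ψ·(ψ∘c)`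
(`mul_galConj_eq_of_valuePairs`); (ii) evaluating at `(2)_∞`, `(3)_∞` gives the Booker–Krishnamurthy
parameter `ν = −1/2` of `φ` (`archParam_eq_neg_half`, `2^a ≠ 3^b`); (iii) at a split place `w`
(`c w ≠ w`) with `𝔭_w^h = (a)`, Neukirch (6.13) for `φ` and `ψ` (`exists_finset_pow_rel`) turns the
unswapped alternative into `(σa/|σa|)^{(k+1)N} = 1` and the swapped one into `(σa/|σa|)^{(k−1)N} = 1`,
and `σa/|σa|` is not a root of unity (`smul_eq_of_div_norm_zpow_eq_one`) — so the SIGN of the global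
parameter `k` decides the alternative UNIFORMLY; (iv) GL(1) rigidity
`ext_of_eventually_valueAtUniformizer_eq`. No density or non-vanishing input.
[cite: NeukirchANT1999, Ch. VII §6 Prop. (6.13) and Cor. (6.14)]
[cite: CasselsFrohlichANT1967, Ch. VII §4 Prop. 4.1 (proof)]
[cite: BookerKrishnamurthy2011, §1.1 (p. 672)] -/
theorem eq_or_eq_galConj_of_valuePairs (hK : IsImaginaryQuadratic K) (c : K ≃ₐ[ℚ] K) (hc : c ≠ 1)
    {φ ψ : HeckeCharacter K} (hinf : ψ.HasInfinityType (fun _ ↦ 1) (fun _ ↦ 0))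
    (hpair : ∀ᶠ w in cofinite,
      (φ.valueAtUniformizer w = ψ.valueAtUniformizer w ∧
          φ.valueAtUniformizer (c • w) = ψ.valueAtUniformizer (c • w)) ∨
        (φ.valueAtUniformizer w = ψ.valueAtUniformizer (c • w) ∧
          φ.valueAtUniformizer (c • w) = ψ.valueAtUniformizer w)) :
    φ = ψ ∨ φ = HeckeCharacter.galConj c ψ := by
  haveI := Rank1Residual.X11b.subsingleton_infinitePlace_of_isImaginaryQuadratic hK
  haveI : IsTotallyComplex K := hK.2
  obtain ⟨w₀⟩ : Nonempty (InfinitePlace K) := inferInstance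
  -- the archimedean parameters of `φ`: `ν = -1/2`, `k`
  obtain ⟨P, hP⟩ := φ.exists_hasArchParams
  have hφ : HasComplexParam (φ.archComponent w₀) (P.ν w₀) (P.k w₀) :=
    (hP w₀).2 (IsTotallyComplex.isComplex w₀)
  have hν : P.ν w₀ = -1 / 2 :=
    archParam_eq_neg_half hK w₀ c hφ hinf (mul_galConj_eq_of_valuePairs c hpair)
  rw [hν] at hφ
  set k : ℤ := P.k w₀ with hk
  set σ : K →+* ℂ := w₀.embedding with hσ
  -- archimedean values
  have hAφ : ∀ x : Kˣ, ((φ (infiniteIdeles K (globalToInfiniteUnits K x)) : ℂˣ) : ℂ) =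
      ((‖σ x‖ : ℂ))⁻¹ * (σ x / (‖σ x‖ : ℂ)) ^ k := fun x ↦ by
    rw [coe_apply_infiniteIdeles_eq_of_hasComplexParam hK w₀ hφ x,
      ofReal_sq_cpow_neg_half (norm_pos_iff.mpr ((map_ne_zero _).mpr x.ne_zero))]
  have hAψ : ∀ x : Kˣ, ((ψ (infiniteIdeles K (globalToInfiniteUnits K x)) : ℂˣ) : ℂ) = (σ x)⁻¹ :=
    coe_apply_infiniteIdeles_eq_of_hasInfinityType_one_zero hK w₀ hinf
  -- Neukirch (6.13) data for `φ`, `ψ`; a principal power of every prime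
  obtain ⟨Tφ, Mφ, hMφ, -, hrelφ⟩ := exists_finset_pow_rel φ
  obtain ⟨Tψ, Mψ, hMψ, hurψ, hrelψ⟩ := exists_finset_pow_rel ψ
  obtain ⟨h, hh, hgen⟩ := exists_pow_asIdeal_eq_span K
  -- the good places: cofinite
  have hT : ∀ T : Finset (HeightOneSpectrum (𝓞 K)), ∀ᶠ w in cofinite, w ∉ T ∧ c • w ∉ T := fun T ↦ by
    refine T.eventually_cofinite_notMem.and ?_
    have hfin : ((fun w : HeightOneSpectrum (𝓞 K) ↦ c • w) ⁻¹' (T : Set _)).Finite :=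
      T.finite_toSet.preimage fun _ _ _ _ e ↦ smul_left_cancel c e
    exact Filter.eventually_cofinite.mpr (hfin.subset fun w hw ↦ by simpa using hw)
  have hgood := hpair.and ((hT Tφ).and (hT Tψ))
  -- KEY: at a good SPLIT place the alternative is decided by the sign of `k`
  have key : ∀ w : HeightOneSpectrum (𝓞 K), (w ∉ Tφ ∧ c • w ∉ Tφ) ∧ (w ∉ Tψ ∧ c • w ∉ Tψ) →
      c • w ≠ w →
      (φ.valueAtUniformizer w = ψ.valueAtUniformizer w → k = -1) ∧
        (φ.valueAtUniformizer w = ψ.valueAtUniformizer (c • w) → k = 1) := by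
    rintro w ⟨⟨hwφ, -⟩, ⟨hwψ, hcwψ⟩⟩ hsplit
    obtain ⟨a, ha, hspan⟩ := hgen w
    have hca : ((c • a : 𝓞 K) : K) ≠ 0 := by
      rw [RingOfIntegers.coe_algEquiv_smul]; exact (map_ne_zero _).mpr ha
    have hspan' : (c • w).asIdeal ^ h = Ideal.span {c • a} := smul_asIdeal_pow_eq_span c hspan
    -- the three relations
    have r1 := hrelφ hwφ ha h hspan
    have r2 := hrelψ hwψ ha h hspan
    have r3 := hrelψ hcwψ hca h hspan'
    rw [hAφ] at r1
    rw [hAψ] at r2 r3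
    simp only [Units.val_mk0] at r1 r2 r3
    rw [RingOfIntegers.coe_algEquiv_smul] at r3
    -- `z = σ a = r u`, `conj z = σ (c a) = r u⁻¹`
    set z : ℂ := σ a with hz
    set r : ℝ := ‖z‖ with hr
    have hz0 : z ≠ 0 := (map_ne_zero σ).mpr ha
    have hr0 : (r : ℂ) ≠ 0 := by exact_mod_cast (norm_pos_iff.mpr hz0).ne'
    set u : ℂ := z / r with hu
    have hu0 : u ≠ 0 := div_ne_zero hz0 hr0
    have hr2 : (r : ℂ) ^ 2 = z * conj z := by
      rw [Complex.mul_conj, Complex.normSq_eq_norm_sq]; push_cast; ring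
    have hzu : z = r * u := by rw [hu]; field_simp
    have hconj : σ (c a) = (r : ℂ) * u⁻¹ := by
      rw [← LemmaXi.conj_embedding_eq_embedding_algEquiv hK.1 c hc σ
        (IsTotallyComplex.complexEmbedding_not_isReal σ) a, ← hz, hu, inv_div, mul_div_assoc',
        ← pow_two, hr2, mul_div_cancel_left₀ _ hz0]
    have hψw : ψ.valueAtUniformizer w ≠ 0 := by
      simp only [HeckeCharacter.valueAtUniformizer]; exact Units.ne_zero _
    have hψcw : ψ.valueAtUniformizer (c • w) ≠ 0 := by
      simp only [HeckeCharacter.valueAtUniformizer]; exact Units.ne_zero _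
    have hN : ((Mφ * Mψ : ℕ) : ℤ) ≠ 0 := by positivity
    constructor
    · intro hA
      rw [hA] at r1
      have e := pow_eq_pow_of_mul_pow_eq_one r1 r2 (pow_ne_zero _ hψw)
      -- `(r⁻¹ u^k)^N = (z⁻¹)^N = (r⁻¹ u⁻¹)^N` ⇒ `u^{(k+1)N} = 1`
      rw [hzu, mul_inv, mul_pow, mul_pow] at e
      have e' : (u ^ k) ^ (Mφ * Mψ) = u⁻¹ ^ (Mφ * Mψ) :=
        mul_left_cancel₀ (pow_ne_zero _ (inv_ne_zero hr0)) e
      have hu1 : u ^ ((k + 1) * ((Mφ * Mψ : ℕ) : ℤ)) = 1 := by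
        rw [zpow_mul, zpow_natCast, zpow_add_one₀ hu0, mul_pow, e', ← mul_pow, inv_mul_cancel₀ hu0,
          one_pow]
      by_contra hk1
      exact hsplit (smul_eq_of_div_norm_zpow_eq_one hK c hc σ ha hh hspan
        (mul_ne_zero (by omega) hN) hu1)
    · intro hB
      rw [hB] at r1
      have e := pow_eq_pow_of_mul_pow_eq_one r1 r3 (pow_ne_zero _ hψcw)
      -- `(r⁻¹ u^k)^N = ((r u⁻¹)⁻¹)^N = (r⁻¹ u)^N` ⇒ `u^{(k-1)N} = 1`
      rw [hconj, mul_inv, inv_inv, mul_pow, mul_pow] at e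
      have e' : (u ^ k) ^ (Mφ * Mψ) = u ^ (Mφ * Mψ) :=
        mul_left_cancel₀ (pow_ne_zero _ (inv_ne_zero hr0)) e
      have hu1 : u ^ ((k - 1) * ((Mφ * Mψ : ℕ) : ℤ)) = 1 := by
        rw [zpow_mul, zpow_natCast, zpow_sub_one₀ hu0, mul_pow, e', ← mul_pow, mul_inv_cancel₀ hu0,
          one_pow]
      by_contra hk1
      exact hsplit (smul_eq_of_div_norm_zpow_eq_one hK c hc σ ha hh hspan
        (mul_ne_zero (by omega) hN) hu1)
  -- conclusion: the sign of `k` decides the alternative everywhere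
  by_cases hk1 : k = 1
  · right
    apply HeckeCharacter.ext_of_eventually_valueAtUniformizer_eq
    filter_upwards [hgood] with w hw
    obtain ⟨hpw, hTφw, hTψw⟩ := hw
    rw [valueAtUniformizer_galConj_of_isUnramifiedAt c ψ w (hurψ _ hTψw.2)]
    by_cases hsplit : c • w = w
    · rcases hpw with ⟨h1, -⟩ | ⟨h1, -⟩
      · rw [h1, hsplit]
      · exact h1
    · rcases hpw with ⟨h1, -⟩ | ⟨h1, -⟩
      · have := (key w ⟨hTφw, hTψw⟩ hsplit).1 h1; omega
      · exact h1
  · left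
    apply HeckeCharacter.ext_of_eventually_valueAtUniformizer_eq
    filter_upwards [hgood] with w hw
    obtain ⟨hpw, hTφw, hTψw⟩ := hw
    by_cases hsplit : c • w = w
    · rcases hpw with ⟨h1, -⟩ | ⟨h1, -⟩
      · exact h1
      · rw [h1, hsplit]
    · rcases hpw with ⟨h1, -⟩ | ⟨h1, -⟩
      · exact h1
      · exact absurd ((key w ⟨hTφw, hTψw⟩ hsplit).2 h1) hk1

end Rigidity

end Summit.BirchSwinnertonDyer.BirchSwinnertonDyer.Theorems.RamifiedSevenEllipticUnits

end
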